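import Mathlib
import HarnessLib

/-!
# The α-rescaled rounding of the cooled charge: the fit objective is continuous with a minimiser on every window, and the rounding-agreement criterion of row 16's two-definition test

HONEST FRAMING: exact (Metropolis-corrected) sampling algorithms for lattice gauge theory;
figures of merit are autocorrelation/cost numbers at stated couplings and volumes; no
continuum-physics claim.

Venture `LatticeQCDFlow` (cell pub-lqcd), sub-topic `Scoring`; FANOUT row 16 (`su2-base`).  The row's scored charge is
`Q = round(α · Q_L)`, `Q_L` the clover charge after `n_cool = 20` cooling sweeps and `α` the rescaling fitted per chain by
minimising the cost `⟨(α Q_L − round(α Q_L))²⟩` over the stored measurements on the window `α ∈ [0.7, 1.6]` (engine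
`latflow.core` `core-0.1.1` `wflow.alpha_rescale`: a 901-point grid search; Del Debbio–Panagopoulos–Vicari, JHEP 08 (2002)
044, named only — the rescaling compensates the `O(a²)` deficit of the lattice charge of a smooth lump); the row's
acceptance test (b) asks that `round(α Q_L)` and the rounded flowed clover charge AGREE on `≥ 95 %` of the flowed
measurements at `β ≥ 2.5`, and that `α Q_L` be within `0.1` of an integer on `≥ 90 %` (CARD-su2-base.md §3 (b)).
NEW WORK of the cell (placement rule), Mathlib only, no definition introduced; nothing is cited as a fact; no number.

## What is proved

* `continuous_abs_sub_round` — `x ↦ |x − round x| = dist(x, ℤ)` is continuous (it is the norm on `ℝ/ℤ = AddCircle 1`);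
  `continuous_alphaCost` — `α ↦ ∑ᵢ |α qᵢ − round(α qᵢ)|²` is continuous; **`exists_isMinOn_alphaCost`** — on every
  window `[α₁, α₂]`, `α₁ ≤ α₂`, the fit objective HAS a minimiser (the engine's grid search approximates a genuine
  minimum; uniqueness is not claimed and fails in general); `alphaCost_le` (the cost is at most `#s/4`).
* `round_eq_of_abs_sub_lt_half` (`|y − n| < ½ ⟹ round y = n`) and **`round_eq_round_of_abs_sub_lt`**: if
  `|y − x| < ½ − |x − round x|` then `round y = round x` — two charge definitions that differ by less than the
  INTEGRALITY MARGIN `½ − dist(x, ℤ)` of either one round to the same integer; with the `0.1` integrality cut of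
  test (b), any two definitions within `0.4` of each other agree (`round_eq_round_of_integrality`).

NOT CLAIMED: that the cooled and flowed charges ARE within the margin (an empirical rate, the row's number); any
property of the minimising `α` (e.g. `α → 1` in the continuum); uniqueness of the minimiser.
-/

namespace Summit.Ventures.LatticeQCDFlow.Scoring

open Set

/-! ## §1 The fit objective -/

/-- `dist(x, ℤ) = |x − round x|` is a continuous function of `x` (the quotient norm of `ℝ/ℤ`). -/
theorem continuous_abs_sub_round : Continuous fun x : ℝ => |x - round x| := by
  have h : (fun x : ℝ => |x - round x|) = fun x : ℝ => ‖((x : ℝ) : AddCircle (1 : ℝ))‖ := by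
    funext x
    rw [AddCircle.norm_eq, inv_one, one_mul, mul_one]
  rw [h]
  exact continuous_norm.comp (AddCircle.continuous_mk' (1 : ℝ))

/-- The α-fit objective `F(α) = ∑ᵢ |α qᵢ − round(α qᵢ)|²` is continuous in `α`. -/
theorem continuous_alphaCost {ι : Type*} (s : Finset ι) (q : ι → ℝ) :
    Continuous fun α : ℝ => ∑ i ∈ s, |α * q i - round (α * q i)| ^ 2 := by
  refine continuous_finsetSum s fun i _ => ?_
  exact (continuous_abs_sub_round.comp (continuous_id.mul continuous_const)).pow 2

/-- **The α-fit is well posed**: on every window `[α₁, α₂]` (`α₁ ≤ α₂`) the objective attains its minimum. -/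
theorem exists_isMinOn_alphaCost {ι : Type*} (s : Finset ι) (q : ι → ℝ) {α₁ α₂ : ℝ} (h : α₁ ≤ α₂) :
    ∃ α ∈ Icc α₁ α₂, IsMinOn (fun α : ℝ => ∑ i ∈ s, |α * q i - round (α * q i)| ^ 2) (Icc α₁ α₂) α :=
  isCompact_Icc.exists_isMinOn (nonempty_Icc.mpr h) (continuous_alphaCost s q).continuousOn

/-- The objective is bounded by `#s / 4` (each term is at most `¼`), so a value near `#s/4` means "no integrality". -/
theorem alphaCost_le {ι : Type*} (s : Finset ι) (q : ι → ℝ) (α : ℝ) :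
    ∑ i ∈ s, |α * q i - round (α * q i)| ^ 2 ≤ s.card / 4 := by
  have h : ∀ i ∈ s, |α * q i - round (α * q i)| ^ 2 ≤ (1 / 4 : ℝ) := fun i _ => by
    have h1 := abs_sub_round (α * q i)
    have h0 := abs_nonneg (α * q i - round (α * q i))
    nlinarith
  calc ∑ i ∈ s, |α * q i - round (α * q i)| ^ 2 ≤ ∑ _i ∈ s, (1 / 4 : ℝ) := Finset.sum_le_sum h
    _ = s.card / 4 := by rw [Finset.sum_const, nsmul_eq_mul]; ring

/-! ## §2 Rounding agreement -/

/-- `|y − n| < ½` forces `round y = n`. -/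
theorem round_eq_of_abs_sub_lt_half {y : ℝ} {n : ℤ} (h : |y - n| < 1 / 2) : round y = n := by
  rw [abs_lt] at h
  rw [round_eq, Int.floor_eq_iff]
  constructor
  · linarith [h.1]
  · linarith [h.2]

/-- **Rounding agreement**: if `y` is closer to `x` than the integrality margin of `x`, `|y − x| < ½ − |x − round x|`,
then `round y = round x`. -/
theorem round_eq_round_of_abs_sub_lt {x y : ℝ} (h : |y - x| < 1 / 2 - |x - round x|) : round y = round x := by
  apply round_eq_of_abs_sub_lt_half
  calc |y - round x| = |(y - x) + (x - round x)| := by ring_nf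
    _ ≤ |y - x| + |x - round x| := abs_add_le _ _
    _ < 1 / 2 := by linarith

/-- With the integrality cut of test (b): if `x` is within `δ` of an integer and `|y − x| < ½ − δ`, the two roundings
agree; e.g. `δ = 0.1`: any two charge definitions within `0.4` of each other round to the same sector. -/
theorem round_eq_round_of_integrality {x y δ : ℝ} (hx : |x - round x| ≤ δ) (h : |y - x| < 1 / 2 - δ) :
    round y = round x :=
  round_eq_round_of_abs_sub_lt (by linarith)

/-- The symmetric form used when BOTH definitions pass the integrality cut: `|x − round x| ≤ δ`, `|y − round y| ≤ δ`
and `|y − x| < 1 − 2δ` give the same integer (for `δ < ¼` this is weaker than asking `|y − x| < ½ − δ`). -/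
theorem round_eq_round_of_integrality_both {x y δ : ℝ} (hx : |x - round x| ≤ δ) (hy : |y - round y| ≤ δ)
    (h : |y - x| < 1 - 2 * δ) : round y = round x := by
  -- the two integers differ by less than 1
  have hlt : |((round y : ℤ) : ℝ) - round x| < 1 := by
    calc |((round y : ℤ) : ℝ) - round x| = |(round y - y) + (y - x) + (x - round x)| := by ring_nf
      _ ≤ |(round y - y) + (y - x)| + |x - round x| := abs_add_le _ _
      _ ≤ |round y - y| + |y - x| + |x - round x| := by linarith [abs_add_le (round y - y : ℝ) (y - x)]
      _ < 1 := by rw [abs_sub_comm (round y : ℝ) y]; linarith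
  have hint : |round y - round x| < (1 : ℤ) := by exact_mod_cast hlt
  have : round y - round x = 0 := by
    rw [abs_lt] at hint
    omega
  omega

end Summit.Ventures.LatticeQCDFlow.Scoring
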